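import Summits.QuantumFields.YangMills.Theorems.BalabanUVNodesN15TwoGridEntry0
import Literature.MathematicalPhysics.QuantumFieldTheory.Balaban1983to89.B5PBridgeKernel126
import HarnessLib

/-!
# Route «BalabanUVNodes», node N15 = NE2, -a lane, part 47: DOOR (iv) — THE LANDAU TERM REDUCED TO ONE KERNEL INEQUALITY: the sandwich
# `G′∘(V′P̂₂ − PV)∘G` (`V = ∂Π∂*`) has an `η^γ` block majorant AS SOON AS the (1.126) kernel of `∂Π∂*` has a cell-summed two-grid η-rate
# (King's Prop. 3.9 SHAPE for Bałaban's kernel); the swap piece `G′∘V′∘(P̂₂ − P)∘G` is `O(η)` HYPOTHESIS-FREE from the tree's (1.126)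

Cell `pub-ymgap`, seat `pub-ymgap-dag-n15-a` (KNIT-BY-NAME, g12); `--supports stmt-QuantumFields-20290 --as helper`; `HOME/pub-ymgap-dag-n15-a/DOOR-IV-PLAN.md` §7.4(a)
(route R; the located hard core).  Over part 46 (`landauRe`, `hasMaj_twoGridDefect_of_landau`), part 44 (`hasMaj_outputSwap_core`), part 42 (`hasMaj_gOp_of_ineq`,
`ineq110_114_pair`), part 39 (`distSite_eq_tdistT`), part 1 (`DefectKernel.hasMaj_ofBlocks_of_rowSum`), lit-balaban's (1.126) for the typed operator
(`B5PBridgeKernel126.norm_GradOp_PcT_GradOp_adjoint_le`: `‖(∂·Π·∂ᴴ) i j‖ ≤ C·(n^{d+1})⁻¹·e^{−δ·distU}`, constants depending on `d` only), King's block geometry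
(`King1986.Torus.mul_tdistT_blocks_le`, `exists_eq_site`) and `B11SectG.hasMaj_comp_exp` on n15-c's unit-torus carrier.
WHAT.  `V′P̂₂ − PV = V′(P̂₂ − P) + (V′P − PV)`.  (§41) An entrywise kernel bound `‖V i j‖ ≤ C·η^{d+1}·e^{−δ|x−x′|}` makes `V = landauRe` an operator with block
majorant `(d+1)·C·e^{δ}·e^{−δ|y−y′|_T}` on King's unit blocks (`hasMaj_landauRe_of_kernelBound`; `|B(x) − B(x′)|_T ≤ distU(x,x′) + 1`), hence ★ `hasMaj_landauRe`
((1.126) ⇒ HasMaj, BOTH grids, hypothesis-free).  (§42) The matrix entry of `V′P − PV` between the fine bond `(x′,μ)` and the coarse bond `(z,ν)` is the CELL-SUMMED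
KERNEL DEFECT `Σ_{w′ ∈ B^η(z)} V′((x′,μ),(w′,ν)) − V((pr x′,μ),(z,ν))` (`landauDefect_single`); IF it is `≤ C_K·(L^k)^{−γ}·(L^k)^{−(d+1)}·e^{−δ_K·distU(pr x′, z)}`
(hypothesis `hK` — King's Prop. 3.9 shape for the kernel of `∂Π∂*`; NOT PRINTED: [B5] never compares two η's) THEN `V′P − PV` has block majorant
`(d+1)·C_K·e^{δ_K}·(L^k)^{−γ}·e^{−δ_K d}` (`hasMaj_landauDefect_of_kernelRate`).  (§43) ★★ `hasMaj_landauSandwich_core` ∕ **`hasMaj_landauSandwich_of_kernelRate`**: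
`hK` ⇒ part 46's hypothesis `hV` (`G′∘(V′∘P̂₂ − P∘V)∘G ≤ C·(L^k)^{−γ}·e^{−δd}`), the swap piece by (1.126) + part 44, the compositions by `hasMaj_comp_exp`; and
★★ **`hasMaj_twoGridDefect_of_kernelRate`**: `hK` (with `0 ≤ γ < 1`) ⇒ ENTRY 0 of `𝔇(G′, G)` for Bałaban's full `G = Δ_a⁻¹` (part 46).  So the located hard core of
door (iv) entry 0 is now ONE inequality about the kernel of `∂Π∂*` alone (route F's F3∕F4 target, exact Lean shape = the binder `hK` below).
HONEST FRAMING ∕ LIMITS.  `hK` is a HYPOTHESIS, not in print and not proved here (the tree holds (1.126)∕(1.127): decay and Hölder continuity of the kernel at ONE η, never a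
comparison of two η's); entries 1–3 ∕ the node readout NOT here; constants crude and ours; tori of record `M_μ = 2L^{m_T}`; `U ≡ 1`; count-neutral (typed 28∕28 · discharged
5∕28 unchanged); NOT a discharge of N15 (object-bound; NE2⁺ NOT PRINTED); one finite T⁴ at fixed ε — NOT infinite volume, NOT OS on ℝ⁴, NOT a mass gap, NOT Clay.
-/

noncomputable section

open scoped BigOperators Matrix
open Finset

namespace Summit.QuantumFields.YangMills.BalabanUVNodes.N15.TwoGrid

open Literature.MathematicalPhysics.QuantumFieldTheory.Balaban1983to89
open Literature.MathematicalPhysics.QuantumFieldTheory.Balaban1983to89.B11SectG (BlockNorm HasMaj hasMaj_comp_exp)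
open Literature.MathematicalPhysics.QuantumFieldTheory.Balaban1983to89.B11AxialTransport190 (abs_le_loc_ofBlocks loc_ofBlocks_le)
open Literature.MathematicalPhysics.QuantumFieldTheory.Balaban1983to89.T4EtaRateCoeffDefect (pull pull_apply fibre mem_fibre)
open Literature.MathematicalPhysics.QuantumFieldTheory.Balaban1983to89.T4EtaRateDefect (idef idef_apply)
open Literature.MathematicalPhysics.QuantumFieldTheory.Balaban1983to89.B5Prop11Plancherel (Tor fine unitVec)
open Literature.MathematicalPhysics.QuantumFieldTheory.Balaban1983to89.B5Action121 (GradOp)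
open Literature.MathematicalPhysics.QuantumFieldTheory.Balaban1983to89.B5Value126 (PcT)
open Literature.MathematicalPhysics.QuantumFieldTheory.Balaban1983to89.B5RealFields (reM)
open Literature.MathematicalPhysics.QuantumFieldTheory.Balaban1983to89.B5Prop12FieldsLattice (distU distSite distU_nonneg)
open Literature.MathematicalPhysics.QuantumFieldTheory.Balaban1983to89.B5SiteBridgeP12 (MP distU_eq_distSite_div)
open Literature.MathematicalPhysics.QuantumFieldTheory.Balaban1983to89.B5SettingP12Real (latticeSettingP12R)
open Literature.MathematicalPhysics.QuantumFieldTheory.Balaban1983to89.B5PBridgeKernel126 (norm_GradOp_PcT_GradOp_adjoint_le)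
open Literature.MathematicalPhysics.QuantumFieldTheory.King1986.Torus (blockOf tdistT tdistT_nonneg tdistT_symm tdistT_triangle site blockOf_site exists_eq_site
  mul_tdistT_blocks_le)
open Literature.MathematicalPhysics.QuantumFieldTheory.Balaban1983to89.B6UnitTorusCarrier (unitTorusGeo unitTorusGeo_dist_nonneg triangle254_unitTorusGeo
  rowSum_unitTorusGeo card_fibre_blockOf)
open Summit.QuantumFields.YangMills.BalabanUVNodes.N15.DefectKernel (hasMaj_ofBlocks_of_rowSum)
open Summit.QuantumFields.YangMills.BalabanUVNodes.N15.VectorPiece (blkFine blkFine_apply kingPr kingPrV kingPr_val kingPrV_eq blkFine_comp_kingPrV)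

variable {d : ℕ}

/-! ## §41 Entrywise kernel bounds ⇒ block majorants on King's unit blocks; (1.126) for `landauRe` on both grids -/

section KernelToBlocks

variable {L : ℕ} (M : Fin (d + 1) → ℕ) [∀ μ, NeZero (M μ)] (k n : ℕ) [NeZero n]

/-- the bonds over a unit block: at most `(d+1)·n^{d+1}`. [folklore] -/
theorem card_fibre_blkBond_le (y : Tor M) :
    (fibre (fun i : Tor (fine n M) × Fin (d + 1) => blockOf n M i.1) y).card ≤ (d + 1) * n ^ (d + 1) := by
  classical
  have hsub : fibre (fun i : Tor (fine n M) × Fin (d + 1) => blockOf n M i.1) y ⊆ fibre (blockOf n M) y ×ˢ (univ : Finset (Fin (d + 1))) := by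
    intro i hi
    exact mem_product.mpr ⟨(mem_fibre (blockOf n M) y i.1).mpr ((mem_fibre (fun i : Tor (fine n M) × Fin (d + 1) => blockOf n M i.1) y i).mp hi), mem_univ _⟩
  refine (card_le_card hsub).trans ?_
  rw [card_product, card_fibre_blockOf, card_univ, Fintype.card_fin, mul_comm]

/-- **BLOCK LABELS ARE 1-LIPSCHITZ IN PHYSICAL UNITS**: `|B(x) − B(x′)|_T ≤ distU(x, x′) + 1` (King's `N·|b − b′|_T ≤ |x − x′|_{T_η} + (N−1)`, `distU = |·|_{T_η}∕N`).
[cite: King1986, p.664 (blocks B^k(x)); Balaban1984PropagatorsI, (1.109) p.35 (|x − x′|)] -/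
theorem tdistT_blockOf_le_distU_add_one (x x' : Tor (fine n M)) : tdistT M (blockOf n M x) (blockOf n M x') ≤ distU n M x x' + 1 := by
  have hn0 : (0 : ℝ) < n := by exact_mod_cast Nat.pos_of_ne_zero (NeZero.ne n)
  obtain ⟨j, hj⟩ := exists_eq_site n M x
  obtain ⟨j', hj'⟩ := exists_eq_site n M x'
  have h := mul_tdistT_blocks_le n M (blockOf n M x) (blockOf n M x') j j'
  rw [← hj, ← hj'] at h
  rw [distU_eq_distSite_div, distSite_eq_tdistT]
  have key : tdistT M (blockOf n M x) (blockOf n M x') ≤ (tdistT (fine n M) x x' + ((n : ℝ) - 1)) / n := by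
    rw [le_div_iff₀ hn0, mul_comm]; exact h
  have h1 : ((n : ℝ) - 1) / n ≤ 1 := by rw [div_le_one hn0]; linarith
  rw [add_div] at key
  linarith

/-- the column of `landauRe` at a bond is the real part of the (1.126) matrix entry. [cite: Balaban1984PropagatorsI, (1.120) p.37, (1.126) p.38] -/
theorem landauRe_single (i j : Tor (fine n M) × Fin (d + 1)) :
    landauRe M n (Pi.single j 1) i = ((GradOp (fine n M) (n : ℂ) * PcT n M (n : ℂ) * (GradOp (fine n M) (n : ℂ))ᴴ) i j).re := by
  classical
  rw [landauRe, Matrix.mulVecLin_apply, Matrix.mulVec_single_one]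
  rfl

/-- **AN ENTRYWISE KERNEL BOUND IS A BLOCK MAJORANT**: if `‖V i j‖ ≤ C·(n^{d+1})⁻¹·e^{−δ·distU(i,j)}` then `landauRe M n` has the block majorant
`(d+1)·C·e^{δ}·e^{−δ|y−y′|_T}` between fine 1-forms blocked by King's unit blocks (`(d+1)n^{d+1}` source bonds per block, `|B(x)−B(z)|_T ≤ distU + 1`).
[cite: Balaban1984PropagatorsI, (1.126) p.38, (1.120) p.37] -/
theorem hasMaj_landauRe_of_kernelBound {C δ : ℝ} (hC : 0 ≤ C) (hδ : 0 ≤ δ)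
    (h : ∀ i j : Tor (fine n M) × Fin (d + 1), ‖(GradOp (fine n M) (n : ℂ) * PcT n M (n : ℂ) * (GradOp (fine n M) (n : ℂ))ᴴ) i j‖
      ≤ C * ((n : ℝ) ^ (d + 1))⁻¹ * Real.exp (-(δ * distU n M i.1 j.1))) :
    HasMaj (BlockNorm.ofBlocks (unitTorusGeo L k M) (fun i : Tor (fine n M) × Fin (d + 1) => blockOf n M i.1))
      (BlockNorm.ofBlocks (unitTorusGeo L k M) (fun i : Tor (fine n M) × Fin (d + 1) => blockOf n M i.1)) (landauRe M n)
      (fun y y' => ((d : ℝ) + 1) * C * Real.exp δ * Real.exp (-(δ * tdistT M y y'))) := by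
  classical
  have hn0 : (0 : ℝ) < (n : ℝ) ^ (d + 1) := pow_pos (by exact_mod_cast Nat.pos_of_ne_zero (NeZero.ne n)) _
  refine hasMaj_ofBlocks_of_rowSum (g := unitTorusGeo L k M) (fun i : Tor (fine n M) × Fin (d + 1) => blockOf n M i.1)
    (fun i : Tor (fine n M) × Fin (d + 1) => blockOf n M i.1) (fun y y' => by positivity) fun i y' => ?_
  -- each entry from a source bond over `y′`
  have hentry : ∀ j ∈ fibre (fun i : Tor (fine n M) × Fin (d + 1) => blockOf n M i.1) y',
      |landauRe M n (Pi.single j 1) i| ≤ C * ((n : ℝ) ^ (d + 1))⁻¹ * (Real.exp δ * Real.exp (-(δ * tdistT M (blockOf n M i.1) y'))) := by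
    intro j hj
    have hjy : blockOf n M j.1 = y' := (mem_fibre (fun i : Tor (fine n M) × Fin (d + 1) => blockOf n M i.1) y' j).mp hj
    rw [landauRe_single]
    refine ((Complex.abs_re_le_norm _).trans (h i j)).trans (mul_le_mul_of_nonneg_left ?_ (mul_nonneg hC (inv_nonneg.mpr hn0.le)))
    rw [← Real.exp_add]
    refine Real.exp_le_exp.mpr ?_
    have hd := tdistT_blockOf_le_distU_add_one M n i.1 j.1
    rw [hjy] at hd
    nlinarith [distU_nonneg (n := n) (M := M) i.1 j.1]
  calc ∑ j ∈ fibre (fun i : Tor (fine n M) × Fin (d + 1) => blockOf n M i.1) y', |landauRe M n (Pi.single j 1) i|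
      ≤ ∑ j ∈ fibre (fun i : Tor (fine n M) × Fin (d + 1) => blockOf n M i.1) y', C * ((n : ℝ) ^ (d + 1))⁻¹ * (Real.exp δ * Real.exp (-(δ * tdistT M (blockOf n M i.1) y'))) :=
        sum_le_sum hentry
    _ ≤ ((d + 1) * n ^ (d + 1) : ℕ) * (C * ((n : ℝ) ^ (d + 1))⁻¹ * (Real.exp δ * Real.exp (-(δ * tdistT M (blockOf n M i.1) y')))) := by
        rw [sum_const, nsmul_eq_mul]
        exact mul_le_mul_of_nonneg_right (by exact_mod_cast card_fibre_blkBond_le M n y') (by positivity)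
    _ = ((d : ℝ) + 1) * C * Real.exp δ * Real.exp (-(δ * tdistT M (blockOf n M i.1) y')) := by
        push_cast
        field_simp

end KernelToBlocks

section Landau126

variable {L : ℕ}

/-- ★ **(1.126) AS A BLOCK MAJORANT, BOTH GRIDS, HYPOTHESIS-FREE**: there are `δ₁, C₁ > 0` (from `d` only) such that for every fineness `n ≥ 1` and every torus `M`, Bałaban's
Landau term `V = ∂Π∂*` on real 1-forms (`landauRe M n`) has the block majorant `C₁·e^{−δ₁|y−y′|_T}` on King's unit blocks — the tree's theorem
`B5PBridgeKernel126.norm_GradOp_PcT_GradOp_adjoint_le` read through §41. [cite: Balaban1984PropagatorsI, (1.126) p.38 «The constant O(1) in (1.126) depends on d only»] -/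
theorem hasMaj_landauRe : ∃ δ₁ C₁ : ℝ, 0 < δ₁ ∧ 0 < C₁ ∧ ∀ (k n : ℕ) [NeZero n] (M : Fin (d + 1) → ℕ) [∀ μ, NeZero (M μ)],
    HasMaj (BlockNorm.ofBlocks (unitTorusGeo L k M) (fun i : Tor (fine n M) × Fin (d + 1) => blockOf n M i.1))
      (BlockNorm.ofBlocks (unitTorusGeo L k M) (fun i : Tor (fine n M) × Fin (d + 1) => blockOf n M i.1)) (landauRe M n)
      (fun y y' => C₁ * Real.exp (-(δ₁ * tdistT M y y'))) := by
  obtain ⟨δ, C, hδ, hC, h⟩ := norm_GradOp_PcT_GradOp_adjoint_le d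
  refine ⟨δ, ((d : ℝ) + 1) * C * Real.exp δ + 1, hδ, by positivity, fun k n _ M _ => ?_⟩
  exact (hasMaj_landauRe_of_kernelBound M k n hC hδ.le (h n M)).mono fun y y' =>
    mul_le_mul_of_nonneg_right (by linarith) (Real.exp_nonneg _)

end Landau126

/-! ## §42 The cell-summed kernel defect of `∂Π∂*` ⇒ a block majorant of `V′P − PV` -/

section LandauDefect

variable {L : ℕ} [NeZero L] (M : Fin (d + 1) → ℕ) [∀ μ, NeZero (M μ)] (k m : ℕ)

/-- **THE MATRIX ENTRY OF `V′P − PV`** between the fine bond `(x′, μ)` and the coarse bond `(z, ν)` is the CELL-SUMMED KERNEL DEFECT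
`Σ_{w′ : pr w′ = z} V′((x′,μ),(w′,ν)) − V((pr x′,μ),(z,ν))` (King's prolongation spreads the source `δ_{(z,ν)}` over the fine bonds `(w′, ν)` over `z`). [cite: King1986, p.664 (the pairing x′ ↦ x), Prop. 3.9 p.664 (η-rate shape)] -/
theorem landauDefect_single (x' : Tor (fine (L ^ m * L ^ k) M)) (μ : Fin (d + 1)) (z : Tor (fine (L ^ k) M)) (ν : Fin (d + 1)) :
    (landauRe M (L ^ m * L ^ k) ∘ₗ pull (kingPrV L k m M) - pull (kingPrV L k m M) ∘ₗ landauRe M (L ^ k)) (Pi.single (z, ν) 1) (x', μ)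
      = ∑ w' ∈ fibre (kingPr L k m M) z, landauRe M (L ^ m * L ^ k) (Pi.single (w', ν) 1) (x', μ)
        - landauRe M (L ^ k) (Pi.single (z, ν) 1) (kingPr L k m M x', μ) := by
  classical
  rw [LinearMap.sub_apply, LinearMap.comp_apply, LinearMap.comp_apply, Pi.sub_apply, pull_apply, kingPrV_eq]
  congr 1
  -- the pulled-back source is the sum of the fine point sources over `z` in direction `ν`
  have hsrc : pull (kingPrV L k m M) (Pi.single (z, ν) (1 : ℝ)) = ∑ w' ∈ fibre (kingPr L k m M) z, Pi.single (w', ν) (1 : ℝ) := by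
    funext i
    obtain ⟨w, κ⟩ := i
    rw [pull_apply, kingPrV_eq, Finset.sum_apply]
    simp only
    by_cases hκ : κ = ν
    · subst hκ
      by_cases hw : kingPr L k m M w = z
      · rw [hw, Pi.single_eq_same, Finset.sum_eq_single w]
        · rw [Pi.single_eq_same]
        · intro w' hw' hne
          rw [Pi.single_eq_of_ne (fun h => hne (Prod.ext_iff.mp h).1.symm)]
        · intro h; exact absurd ((mem_fibre _ _ _).mpr hw) h
      · rw [Pi.single_eq_of_ne (fun h => hw (Prod.ext_iff.mp h).1), Finset.sum_eq_zero]
        intro w' hw'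
        rw [Pi.single_eq_of_ne]
        intro h
        exact hw (by rw [show w = w' from (Prod.ext_iff.mp h).1]; exact (mem_fibre (kingPr L k m M) z w').mp hw')
    · rw [Pi.single_eq_of_ne (fun h => hκ (Prod.ext_iff.mp h).2), Finset.sum_eq_zero]
      intro w' _
      rw [Pi.single_eq_of_ne (fun h => hκ (Prod.ext_iff.mp h).2)]
  rw [hsrc, map_sum, Finset.sum_apply]

/-- ★ **A CELL-SUMMED KERNEL η-RATE OF `∂Π∂*` IS A BLOCK MAJORANT OF `V′P − PV`**: if for all fine bonds `(x′,μ)` and coarse bonds `(z,ν)`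
`|Σ_{w′: pr w′ = z} V′((x′,μ),(w′,ν)) − V((pr x′,μ),(z,ν))| ≤ C_K·R_K·((L^k)^{d+1})⁻¹·e^{−δ_K·distU(pr x′, z)}` (`R_K ≥ 0` the rate factor, e.g. `(L^k)^{−γ}`), then
`landauRe′∘P − P∘landauRe` has the block majorant `(d+1)·C_K·e^{δ_K}·R_K·e^{−δ_K|y−y′|_T}` from coarse 1-forms blocked by King's unit blocks to fine 1-forms blocked likewise.
[cite: King1986, Prop. 3.9 p.664 (η-rate shape); Balaban1984PropagatorsI, (1.126) p.38 (the kernel)] -/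
theorem hasMaj_landauDefect_of_kernelRate {CK δK RK : ℝ} (hCK : 0 ≤ CK) (hδK : 0 ≤ δK) (hRK : 0 ≤ RK)
    (hK : ∀ (x' : Tor (fine (L ^ m * L ^ k) M)) (μ : Fin (d + 1)) (z : Tor (fine (L ^ k) M)) (ν : Fin (d + 1)),
      |∑ w' ∈ fibre (kingPr L k m M) z, landauRe M (L ^ m * L ^ k) (Pi.single (w', ν) 1) (x', μ) - landauRe M (L ^ k) (Pi.single (z, ν) 1) (kingPr L k m M x', μ)|
        ≤ CK * RK * ((((L ^ k : ℕ) : ℝ)) ^ (d + 1))⁻¹ * Real.exp (-(δK * distU (L ^ k) M (kingPr L k m M x') z))) :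
    HasMaj (BlockNorm.ofBlocks (unitTorusGeo L k M) (blkFine L k M))
      (BlockNorm.ofBlocks (unitTorusGeo L k M) (fun i : Tor (fine (L ^ m * L ^ k) M) × Fin (d + 1) => blockOf (L ^ m * L ^ k) M i.1))
      (landauRe M (L ^ m * L ^ k) ∘ₗ pull (kingPrV L k m M) - pull (kingPrV L k m M) ∘ₗ landauRe M (L ^ k))
      (fun y y' => ((d : ℝ) + 1) * CK * Real.exp δK * RK * Real.exp (-(δK * tdistT M y y'))) := by
  classical
  have hL0 : 0 < L := Nat.pos_of_ne_zero (NeZero.ne L)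
  have hn0 : (0 : ℝ) < (((L ^ k : ℕ) : ℝ)) ^ (d + 1) := pow_pos (by exact_mod_cast Nat.one_le_pow _ _ hL0) _
  refine hasMaj_ofBlocks_of_rowSum (g := unitTorusGeo L k M) (blkFine L k M)
    (fun i : Tor (fine (L ^ m * L ^ k) M) × Fin (d + 1) => blockOf (L ^ m * L ^ k) M i.1) (fun y y' => by positivity) fun i y' => ?_
  obtain ⟨x', μ⟩ := i
  have hblk : blockOf (L ^ m * L ^ k) M x' = blockOf (L ^ k) M (kingPr L k m M x') := by
    have hx := congrFun (blkFine_comp_kingPrV M L k m) (x', μ)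
    simp only [Function.comp, blkFine_apply, kingPrV_eq] at hx
    exact hx.symm
  have hentry : ∀ j ∈ fibre (blkFine L k M) y',
      |(landauRe M (L ^ m * L ^ k) ∘ₗ pull (kingPrV L k m M) - pull (kingPrV L k m M) ∘ₗ landauRe M (L ^ k)) (Pi.single j 1) (x', μ)|
        ≤ CK * RK * ((((L ^ k : ℕ) : ℝ)) ^ (d + 1))⁻¹ * (Real.exp δK * Real.exp (-(δK * tdistT M (blockOf (L ^ m * L ^ k) M x') y'))) := by
    rintro ⟨z, ν⟩ hj
    have hzy : blockOf (L ^ k) M z = y' := (mem_fibre (blkFine L k M) y' (z, ν)).mp hj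
    rw [landauDefect_single]
    refine (hK x' μ z ν).trans (mul_le_mul_of_nonneg_left ?_ (mul_nonneg (mul_nonneg hCK hRK) (inv_nonneg.mpr hn0.le)))
    rw [← Real.exp_add]
    refine Real.exp_le_exp.mpr ?_
    have hd := tdistT_blockOf_le_distU_add_one M (L ^ k) (kingPr L k m M x') z
    rw [hzy, ← hblk] at hd
    nlinarith [distU_nonneg (n := L ^ k) (M := M) (kingPr L k m M x') z]
  calc ∑ j ∈ fibre (blkFine L k M) y', |(landauRe M (L ^ m * L ^ k) ∘ₗ pull (kingPrV L k m M) - pull (kingPrV L k m M) ∘ₗ landauRe M (L ^ k)) (Pi.single j 1) (x', μ)|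
      ≤ ∑ j ∈ fibre (blkFine L k M) y', CK * RK * ((((L ^ k : ℕ) : ℝ)) ^ (d + 1))⁻¹ * (Real.exp δK * Real.exp (-(δK * tdistT M (blockOf (L ^ m * L ^ k) M x') y'))) :=
        sum_le_sum hentry
    _ ≤ ((d + 1) * (L ^ k) ^ (d + 1) : ℕ) * (CK * RK * ((((L ^ k : ℕ) : ℝ)) ^ (d + 1))⁻¹ * (Real.exp δK * Real.exp (-(δK * tdistT M (blockOf (L ^ m * L ^ k) M x') y')))) := by
        rw [sum_const, nsmul_eq_mul]
        exact mul_le_mul_of_nonneg_right (by exact_mod_cast card_fibre_blkBond_le M (L ^ k) y') (by positivity)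
    _ = ((d : ℝ) + 1) * CK * Real.exp δK * RK * Real.exp (-(δK * tdistT M (blockOf (L ^ m * L ^ k) M x') y')) := by
        push_cast
        field_simp

end LandauDefect

/-! ## §43 ★★ The Landau sandwich from the kernel rate, and entry 0 of `𝔇(G′, G)` from the kernel rate -/

section Sandwich

variable {L : ℕ} [NeZero L] (M : Fin (d + 1) → ℕ) [∀ μ, NeZero (M μ)] (k m : ℕ) (a : ℝ)

/-- ★★ **CORE (one torus, explicit constants)**: the (1.110) packages of both members (`HP1`, `HP2`), the (1.126) block majorants of `V′` (`hV′`), and the cell-summed kernel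
rate `hK` give `G′∘(V′∘P̂₂ − P∘V)∘G` the block majorant `[C₀·C₁·A₄·c(τ∕2)·c(τ∕4)·C₀·(L^k)⁻¹ + C₀·((d+1)C_Ke^{δ_K}R_K)·C₀·c(τ∕2)·c(τ∕4)]·e^{−(τ∕4)d}`-type bound (`τ = min(δ₀, δ₁, δ_K)`,
`A₄` part 44's output-swap constant, `c(σ) = latticeConst(d+1, σ)`). [cite: Balaban1984PropagatorsI, Prop. 1.2 (1.110) p.35, (1.126) p.38; King1986, Prop. 3.9 p.664] -/
theorem hasMaj_landauSandwich_core {C₀ δ₀ : ℝ} {Cα Cε : ℝ → ℝ} {Cαε : ℝ → ℝ → ℝ} (hC₀ : 0 < C₀) (hδ₀ : 0 < δ₀)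
    (HP1 : B5.Ineq110_114 (latticeSettingP12R (L ^ k) M a k) C₀ Cα Cε Cαε δ₀)
    (HP2 : B5.Ineq110_114 (latticeSettingP12R (L ^ m * L ^ k) M a (m + k)) C₀ Cα Cε Cαε δ₀)
    {C₁ δ₁ : ℝ} (hC₁ : 0 < C₁) (hδ₁ : 0 < δ₁)
    (hV' : HasMaj (BlockNorm.ofBlocks (unitTorusGeo L k M) (fun i : Tor (fine (L ^ m * L ^ k) M) × Fin (d + 1) => blockOf (L ^ m * L ^ k) M i.1))
      (BlockNorm.ofBlocks (unitTorusGeo L k M) (fun i : Tor (fine (L ^ m * L ^ k) M) × Fin (d + 1) => blockOf (L ^ m * L ^ k) M i.1)) (landauRe M (L ^ m * L ^ k))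
      (fun y y' => C₁ * Real.exp (-(δ₁ * tdistT M y y'))))
    {CK δK RK : ℝ} (hCK : 0 < CK) (hδK : 0 < δK) (hRK : 0 ≤ RK)
    (hK : ∀ (x' : Tor (fine (L ^ m * L ^ k) M)) (μ : Fin (d + 1)) (z : Tor (fine (L ^ k) M)) (ν : Fin (d + 1)),
      |∑ w' ∈ fibre (kingPr L k m M) z, landauRe M (L ^ m * L ^ k) (Pi.single (w', ν) 1) (x', μ) - landauRe M (L ^ k) (Pi.single (z, ν) 1) (kingPr L k m M x', μ)|
        ≤ CK * RK * ((((L ^ k : ℕ) : ℝ)) ^ (d + 1))⁻¹ * Real.exp (-(δK * distU (L ^ k) M (kingPr L k m M x') z))) :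
    HasMaj (BlockNorm.ofBlocks (unitTorusGeo L k M) (blkFine L k M)) (BlockNorm.ofBlocks (unitTorusGeo L k M) (fun i : Tor (fine (L ^ m * L ^ k) M) × Fin (d + 1) => blockOf (L ^ m * L ^ k) M i.1))
      (gOp M (L ^ m * L ^ k) a ∘ₗ ((landauRe M (L ^ m * L ^ k) ∘ₗ symbOp M (L ^ m * L ^ k) (sSm M (L ^ m * L ^ k) (L ^ m)) ∘ₗ pull (kingPrV L k m M)
        - pull (kingPrV L k m M) ∘ₗ landauRe M (L ^ k)) ∘ₗ gOp M (L ^ k) a))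
      (fun y y' => (C₀ * (C₁ * (((d : ℝ) + 1) * (2 * C₀ * Real.exp δ₀ ^ (2 * d + 1))) * B4Sect5Proof.latticeConst (d + 1) (min (min δ₀ δ₁) δK / 2))
          * B4Sect5Proof.latticeConst (d + 1) (min (min δ₀ δ₁) δK / 4) * ((L ^ k : ℕ) : ℝ)⁻¹
        + C₀ * ((((d : ℝ) + 1) * CK * Real.exp δK * RK) * C₀ * B4Sect5Proof.latticeConst (d + 1) (min (min δ₀ δ₁) δK / 2))
          * B4Sect5Proof.latticeConst (d + 1) (min (min δ₀ δ₁) δK / 4))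
        * Real.exp (-(min (min δ₀ δ₁) δK / 4 * tdistT M y y'))) := by
  classical
  set τ := min (min δ₀ δ₁) δK with hτ
  have hτ0 : 0 < τ := lt_min (lt_min hδ₀ hδ₁) hδK
  have hτδ₀ : τ ≤ δ₀ := (min_le_left _ _).trans (min_le_left _ _)
  have hτδ₁ : τ ≤ δ₁ := (min_le_left _ _).trans (min_le_right _ _)
  have hτδK : τ ≤ δK := min_le_right _ _
  have hc2 : 0 ≤ B4Sect5Proof.latticeConst (d + 1) (τ / 2) := B4Sect5Proof.latticeConst_nonneg (d + 1) (by linarith)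
  have hc4 : 0 ≤ B4Sect5Proof.latticeConst (d + 1) (τ / 4) := B4Sect5Proof.latticeConst_nonneg (d + 1) (by linarith)
  have hL0 : 0 < L := Nat.pos_of_ne_zero (NeZero.ne L)
  have hn1 : 1 ≤ L ^ k := Nat.one_le_pow _ _ hL0
  have hn'1 : 1 ≤ L ^ m * L ^ k := Nat.one_le_iff_ne_zero.mpr (Nat.mul_ne_zero (by positivity) (by positivity))
  have hn0 : (0 : ℝ) < ((L ^ k : ℕ) : ℝ) := by exact_mod_cast hn1
  set bC := BlockNorm.ofBlocks (unitTorusGeo L k M) (blkFine L k M) with hbC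
  set bF := BlockNorm.ofBlocks (unitTorusGeo L k M) (fun i : Tor (fine (L ^ m * L ^ k) M) × Fin (d + 1) => blockOf (L ^ m * L ^ k) M i.1) with hbF
  have hκF : bF.κ = 1 := rfl
  have hκC : bC.κ = 1 := rfl
  -- the two propagators' entry «GJ»
  have hG' : HasMaj bF bF (gOp M (L ^ m * L ^ k) a) (fun y y' => C₀ * Real.exp (-(δ₀ * tdistT M y y'))) := hasMaj_gOp_of_ineq M k (L ^ m * L ^ k) a hn'1 HP2 hC₀.le
  have hG : HasMaj bC bC (gOp M (L ^ k) a) (fun y y' => C₀ * Real.exp (-(δ₀ * tdistT M y y'))) := hasMaj_gOp_of_ineq M k (L ^ k) a hn1 HP1 hC₀.le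
  -- (1) the swap piece `V′∘(P̂₂ − P)∘G`
  have hsw := hasMaj_outputSwap_core (L := L) M k m a hC₀ hδ₀ HP1
  have hA4 : 0 ≤ ((d : ℝ) + 1) * (2 * C₀ * Real.exp δ₀ ^ (2 * d + 1)) * ((L ^ k : ℕ) : ℝ)⁻¹ := by positivity
  have h1a : HasMaj bC bF (landauRe M (L ^ m * L ^ k) ∘ₗ (((symbOp M (L ^ m * L ^ k) (sSm M (L ^ m * L ^ k) (L ^ m)) ∘ₗ pull (kingPrV L k m M)) - pull (kingPrV L k m M)) ∘ₗ gOp M (L ^ k) a))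
      (fun y y' => bF.κ * C₁ * (((d : ℝ) + 1) * (2 * C₀ * Real.exp δ₀ ^ (2 * d + 1)) * ((L ^ k : ℕ) : ℝ)⁻¹) * B4Sect5Proof.latticeConst (d + 1) (τ / 2) *
        Real.exp (-(τ / 2 * tdistT M y y'))) :=
    hasMaj_comp_exp (b₁ := bC) (b₂ := bF) (b₃ := bF) (triangle254_unitTorusGeo L k M) (unitTorusGeo_dist_nonneg L k M) (rowSum_unitTorusGeo L k M (by linarith : 0 < τ / 2))
      hC₁.le hA4 (by linarith) (by linarith) (by linarith) hV' hsw
  have hB1 : 0 ≤ bF.κ * C₁ * (((d : ℝ) + 1) * (2 * C₀ * Real.exp δ₀ ^ (2 * d + 1)) * ((L ^ k : ℕ) : ℝ)⁻¹) * B4Sect5Proof.latticeConst (d + 1) (τ / 2) := by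
    rw [hκF]; positivity
  have h1 : HasMaj bC bF (gOp M (L ^ m * L ^ k) a ∘ₗ (landauRe M (L ^ m * L ^ k) ∘ₗ (((symbOp M (L ^ m * L ^ k) (sSm M (L ^ m * L ^ k) (L ^ m)) ∘ₗ pull (kingPrV L k m M)) - pull (kingPrV L k m M)) ∘ₗ gOp M (L ^ k) a)))
      (fun y y' => bF.κ * C₀ * (bF.κ * C₁ * (((d : ℝ) + 1) * (2 * C₀ * Real.exp δ₀ ^ (2 * d + 1)) * ((L ^ k : ℕ) : ℝ)⁻¹) * B4Sect5Proof.latticeConst (d + 1) (τ / 2)) *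
        B4Sect5Proof.latticeConst (d + 1) (τ / 4) * Real.exp (-(τ / 4 * tdistT M y y'))) :=
    hasMaj_comp_exp (b₁ := bC) (b₂ := bF) (b₃ := bF) (triangle254_unitTorusGeo L k M) (unitTorusGeo_dist_nonneg L k M) (rowSum_unitTorusGeo L k M (by linarith : 0 < τ / 4))
      hC₀.le hB1 (by linarith) (by linarith) (by linarith) hG' h1a
  -- (2) the kernel-rate piece `(V′P − PV)∘G`
  have hD := hasMaj_landauDefect_of_kernelRate M k m hCK.le hδK.le hRK hK
  have hBD : 0 ≤ ((d : ℝ) + 1) * CK * Real.exp δK * RK := by positivity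
  have h2a : HasMaj bC bF ((landauRe M (L ^ m * L ^ k) ∘ₗ pull (kingPrV L k m M) - pull (kingPrV L k m M) ∘ₗ landauRe M (L ^ k)) ∘ₗ gOp M (L ^ k) a)
      (fun y y' => bC.κ * (((d : ℝ) + 1) * CK * Real.exp δK * RK) * C₀ * B4Sect5Proof.latticeConst (d + 1) (τ / 2) * Real.exp (-(τ / 2 * tdistT M y y'))) :=
    hasMaj_comp_exp (b₁ := bC) (b₂ := bC) (b₃ := bF) (triangle254_unitTorusGeo L k M) (unitTorusGeo_dist_nonneg L k M) (rowSum_unitTorusGeo L k M (by linarith : 0 < τ / 2))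
      hBD hC₀.le (by linarith) (by linarith) (by linarith) hD hG
  have hB2 : 0 ≤ bC.κ * (((d : ℝ) + 1) * CK * Real.exp δK * RK) * C₀ * B4Sect5Proof.latticeConst (d + 1) (τ / 2) := by rw [hκC]; positivity
  have h2 : HasMaj bC bF (gOp M (L ^ m * L ^ k) a ∘ₗ ((landauRe M (L ^ m * L ^ k) ∘ₗ pull (kingPrV L k m M) - pull (kingPrV L k m M) ∘ₗ landauRe M (L ^ k)) ∘ₗ gOp M (L ^ k) a))
      (fun y y' => bF.κ * C₀ * (bC.κ * (((d : ℝ) + 1) * CK * Real.exp δK * RK) * C₀ * B4Sect5Proof.latticeConst (d + 1) (τ / 2)) * B4Sect5Proof.latticeConst (d + 1) (τ / 4) *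
        Real.exp (-(τ / 4 * tdistT M y y'))) :=
    hasMaj_comp_exp (b₁ := bC) (b₂ := bF) (b₃ := bF) (triangle254_unitTorusGeo L k M) (unitTorusGeo_dist_nonneg L k M) (rowSum_unitTorusGeo L k M (by linarith : 0 < τ / 4))
      hC₀.le hB2 (by linarith) (by linarith) (by linarith) hG' h2a
  -- (3) sum and operator identity `V′P̂₂ − PV = V′(P̂₂ − P) + (V′P − PV)`
  refine ((h1.add h2).congr fun μ => ?_).mono fun y y' => le_of_eq ?_
  · simp only [LinearMap.add_apply, LinearMap.comp_apply, LinearMap.sub_apply, map_sub]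
    abel
  · rw [hκF, hκC]; ring

/-- ★★ **THE LANDAU SANDWICH FROM ONE KERNEL INEQUALITY.**  For odd `L > 1`, `a > 0`, `γ ≤ 1`: IF the (1.126) kernel of `∂Π∂*` has the CELL-SUMMED TWO-GRID η-RATE
`|Σ_{w′: pr w′ = z} V_{η′}((x′,μ),(w′,ν)) − V_η((pr x′,μ),(z,ν))| ≤ C_K·(L^k)^{−γ}·((L^k)^{d+1})⁻¹·e^{−δ_K·distU(pr x′, z)}` on the torus family of record (all `m_T`, `k ≥ 1`, `m`;
King's Prop. 3.9 SHAPE for Bałaban's kernel — the binder `hK`), THEN part 46's hypothesis holds: `G′∘(V′∘P̂₂ − P∘V)∘G` has a block majorant `C·(L^k)^{−γ}·e^{−δ|y−y′|_T}`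
(`γ ≤ 1`; the swap piece is `O(η)` by the tree's (1.126)). [cite: Balaban1984PropagatorsI, (1.126) p.38, Prop. 1.2 (1.110) p.35; King1986, Prop. 3.9 p.664 (η-rate shape)] -/
theorem hasMaj_landauSandwich_of_kernelRate (hL : Odd L ∧ 1 < L) {a : ℝ} (ha : 0 < a) {γ : ℝ} (hγ1 : γ ≤ 1) {δK CK : ℝ} (hδK : 0 < δK) (hCK : 0 < CK)
    (hK : ∀ (mT k m : ℕ) (hk : 1 ≤ k) (x' : Tor (fine (L ^ m * L ^ k) (MP (paramsOf d L mT k hL)))) (μ : Fin (d + 1))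
      (z : Tor (fine (L ^ k) (MP (paramsOf d L mT k hL)))) (ν : Fin (d + 1)),
      |∑ w' ∈ fibre (kingPr L k m (MP (paramsOf d L mT k hL))) z, landauRe (MP (paramsOf d L mT k hL)) (L ^ m * L ^ k) (Pi.single (w', ν) 1) (x', μ)
          - landauRe (MP (paramsOf d L mT k hL)) (L ^ k) (Pi.single (z, ν) 1) (kingPr L k m (MP (paramsOf d L mT k hL)) x', μ)|
        ≤ CK * ((L ^ k : ℕ) : ℝ) ^ (-γ) * ((((L ^ k : ℕ) : ℝ)) ^ (d + 1))⁻¹ * Real.exp (-(δK * distU (L ^ k) (MP (paramsOf d L mT k hL)) (kingPr L k m (MP (paramsOf d L mT k hL)) x') z))) :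
    ∃ δ C : ℝ, 0 < δ ∧ 0 < C ∧ ∀ (mT k m : ℕ) (hk : 1 ≤ k),
      HasMaj (BlockNorm.ofBlocks (unitTorusGeo L k (MP (paramsOf d L mT k hL))) (blkFine L k (MP (paramsOf d L mT k hL))))
        (BlockNorm.ofBlocks (unitTorusGeo L k (MP (paramsOf d L mT k hL)))
          (fun i : Tor (fine (L ^ m * L ^ k) (MP (paramsOf d L mT k hL))) × Fin (d + 1) => blockOf (L ^ m * L ^ k) (MP (paramsOf d L mT k hL)) i.1))
        (gOp (MP (paramsOf d L mT k hL)) (L ^ m * L ^ k) a ∘ₗ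
          ((landauRe (MP (paramsOf d L mT k hL)) (L ^ m * L ^ k) ∘ₗ
              symbOp (MP (paramsOf d L mT k hL)) (L ^ m * L ^ k) (sSm (MP (paramsOf d L mT k hL)) (L ^ m * L ^ k) (L ^ m)) ∘ₗ pull (kingPrV L k m (MP (paramsOf d L mT k hL)))
            - pull (kingPrV L k m (MP (paramsOf d L mT k hL))) ∘ₗ landauRe (MP (paramsOf d L mT k hL)) (L ^ k)) ∘ₗ gOp (MP (paramsOf d L mT k hL)) (L ^ k) a))
        (fun y y' => C * ((L ^ k : ℕ) : ℝ) ^ (-γ) * Real.exp (-(δ * tdistT (MP (paramsOf d L mT k hL)) y y'))) := by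
  obtain ⟨δ₀, C₀, Cα, Cε, Cαε, hδ₀, hC₀, HP⟩ := ineq110_114_pair (d := d) hL ha
  obtain ⟨δ₁, C₁, hδ₁, hC₁, H1⟩ := hasMaj_landauRe (d := d) (L := L)
  set τ := min (min δ₀ δ₁) δK with hτ
  have hτ0 : 0 < τ := lt_min (lt_min hδ₀ hδ₁) hδK
  set c2 := B4Sect5Proof.latticeConst (d + 1) (τ / 2) with hc2
  set c4 := B4Sect5Proof.latticeConst (d + 1) (τ / 4) with hc4
  have hc2' : 0 ≤ c2 := B4Sect5Proof.latticeConst_nonneg (d + 1) (by linarith)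
  have hc4' : 0 ≤ c4 := B4Sect5Proof.latticeConst_nonneg (d + 1) (by linarith)
  refine ⟨τ / 4, C₀ * (C₁ * (((d : ℝ) + 1) * (2 * C₀ * Real.exp δ₀ ^ (2 * d + 1))) * c2) * c4 + C₀ * ((((d : ℝ) + 1) * CK * Real.exp δK) * C₀ * c2) * c4 + 1,
    by linarith, by positivity, fun mT k m hk => ?_⟩
  haveI : NeZero (L ^ m * L ^ k) := ⟨Nat.mul_ne_zero (pow_ne_zero _ (NeZero.ne L)) (pow_ne_zero _ (NeZero.ne L))⟩
  have hn1 : (1 : ℝ) ≤ ((L ^ k : ℕ) : ℝ) := by exact_mod_cast Nat.one_le_pow _ _ (Nat.pos_of_ne_zero (NeZero.ne L))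
  have hn0 : (0 : ℝ) < ((L ^ k : ℕ) : ℝ) := by linarith
  have hrγ : 0 ≤ ((L ^ k : ℕ) : ℝ) ^ (-γ) := Real.rpow_nonneg hn0.le _
  have hinv : ((L ^ k : ℕ) : ℝ)⁻¹ ≤ ((L ^ k : ℕ) : ℝ) ^ (-γ) := by
    rw [← Real.rpow_neg_one]
    exact Real.rpow_le_rpow_of_exponent_le hn1 (by linarith)
  refine (hasMaj_landauSandwich_core (MP (paramsOf d L mT k hL)) k m a hC₀ hδ₀ (HP mT k m hk).1 (HP mT k m hk).2 hC₁ hδ₁ (H1 k (L ^ m * L ^ k) (MP (paramsOf d L mT k hL)))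
    hCK hδK hrγ (hK mT k m hk)).mono fun y y' => ?_
  have hE := Real.exp_nonneg (-(τ / 4 * tdistT (MP (paramsOf d L mT k hL)) y y'))
  have hX1 : 0 ≤ C₀ * (C₁ * (((d : ℝ) + 1) * (2 * C₀ * Real.exp δ₀ ^ (2 * d + 1))) * c2) * c4 := by positivity
  have hX2 : 0 ≤ C₀ * ((((d : ℝ) + 1) * CK * Real.exp δK) * C₀ * c2) * c4 := by positivity
  calc (C₀ * (C₁ * (((d : ℝ) + 1) * (2 * C₀ * Real.exp δ₀ ^ (2 * d + 1))) * c2) * c4 * ((L ^ k : ℕ) : ℝ)⁻¹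
        + C₀ * ((((d : ℝ) + 1) * CK * Real.exp δK * ((L ^ k : ℕ) : ℝ) ^ (-γ)) * C₀ * c2) * c4) * Real.exp (-(τ / 4 * tdistT (MP (paramsOf d L mT k hL)) y y'))
      = (C₀ * (C₁ * (((d : ℝ) + 1) * (2 * C₀ * Real.exp δ₀ ^ (2 * d + 1))) * c2) * c4 * ((L ^ k : ℕ) : ℝ)⁻¹
        + C₀ * ((((d : ℝ) + 1) * CK * Real.exp δK) * C₀ * c2) * c4 * ((L ^ k : ℕ) : ℝ) ^ (-γ)) * Real.exp (-(τ / 4 * tdistT (MP (paramsOf d L mT k hL)) y y')) := by ring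
    _ ≤ (C₀ * (C₁ * (((d : ℝ) + 1) * (2 * C₀ * Real.exp δ₀ ^ (2 * d + 1))) * c2) * c4 * ((L ^ k : ℕ) : ℝ) ^ (-γ)
        + C₀ * ((((d : ℝ) + 1) * CK * Real.exp δK) * C₀ * c2) * c4 * ((L ^ k : ℕ) : ℝ) ^ (-γ)) * Real.exp (-(τ / 4 * tdistT (MP (paramsOf d L mT k hL)) y y')) :=
        mul_le_mul_of_nonneg_right (by nlinarith [mul_le_mul_of_nonneg_left hinv hX1]) hE
    _ ≤ _ := by
        rw [← add_mul]
        exact mul_le_mul_of_nonneg_right (mul_le_mul_of_nonneg_right (by linarith) hrγ) hE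

/-- ★★ **ENTRY 0 OF `𝔇(G′, G)` FOR BAŁABAN's FULL PROPAGATOR FROM ONE KERNEL INEQUALITY**: under the cell-summed two-grid η-rate `hK` of the (1.126) kernel of `∂Π∂*` (rate
exponent `0 ≤ γ < 1`), `𝔇(G′, G) = idef P P G′ G` has a block majorant `C·(L^k)^{−γ}·e^{−δ|y−y′|_T}` on the torus family of record — parts 43∕44∕45 (hypothesis-free) + §43 + part
46. [cite: Balaban1984PropagatorsI, Prop. 1.2 (1.110)–(1.111) p.35, (1.126) p.38; Balaban1985BackgroundPropagators, (3.42) p.397 (first entry, shape); King1986, Prop. 3.9 p.664] -/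
theorem hasMaj_twoGridDefect_of_kernelRate (hL : Odd L ∧ 1 < L) {a : ℝ} (ha : 0 < a) {γ : ℝ} (hγ0 : 0 ≤ γ) (hγ1 : γ < 1) {δK CK : ℝ} (hδK : 0 < δK) (hCK : 0 < CK)
    (hK : ∀ (mT k m : ℕ) (hk : 1 ≤ k) (x' : Tor (fine (L ^ m * L ^ k) (MP (paramsOf d L mT k hL)))) (μ : Fin (d + 1))
      (z : Tor (fine (L ^ k) (MP (paramsOf d L mT k hL)))) (ν : Fin (d + 1)),
      |∑ w' ∈ fibre (kingPr L k m (MP (paramsOf d L mT k hL))) z, landauRe (MP (paramsOf d L mT k hL)) (L ^ m * L ^ k) (Pi.single (w', ν) 1) (x', μ)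
          - landauRe (MP (paramsOf d L mT k hL)) (L ^ k) (Pi.single (z, ν) 1) (kingPr L k m (MP (paramsOf d L mT k hL)) x', μ)|
        ≤ CK * ((L ^ k : ℕ) : ℝ) ^ (-γ) * ((((L ^ k : ℕ) : ℝ)) ^ (d + 1))⁻¹ * Real.exp (-(δK * distU (L ^ k) (MP (paramsOf d L mT k hL)) (kingPr L k m (MP (paramsOf d L mT k hL)) x') z))) :
    ∃ δ C : ℝ, 0 < δ ∧ 0 < C ∧ ∀ (mT k m : ℕ) (hk : 1 ≤ k),
      HasMaj (BlockNorm.ofBlocks (unitTorusGeo L k (MP (paramsOf d L mT k hL))) (blkFine L k (MP (paramsOf d L mT k hL))))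
        (BlockNorm.ofBlocks (unitTorusGeo L k (MP (paramsOf d L mT k hL)))
          (fun i : Tor (fine (L ^ m * L ^ k) (MP (paramsOf d L mT k hL))) × Fin (d + 1) => blockOf (L ^ m * L ^ k) (MP (paramsOf d L mT k hL)) i.1))
        (idef (pull (kingPrV L k m (MP (paramsOf d L mT k hL)))) (pull (kingPrV L k m (MP (paramsOf d L mT k hL))))
          (gOp (MP (paramsOf d L mT k hL)) (L ^ m * L ^ k) a) (gOp (MP (paramsOf d L mT k hL)) (L ^ k) a))
        (fun y y' => C * ((L ^ k : ℕ) : ℝ) ^ (-γ) * Real.exp (-(δ * tdistT (MP (paramsOf d L mT k hL)) y y'))) := by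
  obtain ⟨δV, CV, hδV, hCV, hV⟩ := hasMaj_landauSandwich_of_kernelRate (d := d) hL ha hγ1.le hδK hCK hK
  exact hasMaj_twoGridDefect_of_landau (d := d) hL ha hγ0 hγ1 hδV hCV hV

end Sandwich

end Summit.QuantumFields.YangMills.BalabanUVNodes.N15.TwoGrid
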